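import Summits.RiemannHypothesis.RiemannHypothesis.Theses.WeilComb
import Summits.RiemannHypothesis.RiemannHypothesis.Theorems.WeilCombCombShapeDetection
import Summits.RiemannHypothesis.RiemannHypothesis.Theorems.WeilCombCombShapePositivityStubDilationSeries
import Summits.RiemannHypothesis.RiemannHypothesis.Theorems.WeilCombCombShapePositivityStubTwoPrimeCollapse
import Summits.RiemannHypothesis.RiemannHypothesis.Theorems.WeilCombCombShapePositivityFejerOfCrux
import Summits.RiemannHypothesis.RiemannHypothesis.Theorems.FejerDivisorPositivity
import Literature.NumberTheory.LFunctions.WeilCriterionConverse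
import Mathlib

/-!
# Width rigidity of fixed-shape comb positivity: `stub_widthRigidity`

Registered helper (`ledger workitem stub-add … --name stub_widthRigidity`) of the crux
`WeilComb.CombShapePositivity` (item stmt-RiemannHypothesis-11229, route route-RiemannHypothesis-WeilComb,
line `Sketch`, stub-plan `Cruxes/CombShapePositivity/STUB-PLAN-stub_fejer.md`; sprove seat c1). A theorem
ABOUT the RH-equivalent input `stub_fejer`/`CombShapePositivity`, not a step of `CombShapePositivity_of`.

Write `crux(ε)` for the conjunction of all cells of ONE width: `∀ M a, 0 ≤ Re Q(Σ_{m≤M} a_m φ_ε(· − log m))`,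
`φ_ε(t) = ε⁻¹ φ₀(t/ε)`, `φ₀(u) = expNegInvGlue (1 − u²)`, `Q(g) = W(g ⋆ g̃)`.

**Theorem (width rigidity).** If the Riemann hypothesis fails, the set `{ε > 0 | crux(ε)}` is countable.
Equivalently: `crux` on any uncountable set of widths — e.g. on any interval `[ε₁, ε₂]`, `0 < ε₁ < ε₂` —
is already `RiemannHypothesis`; a single *generic* width carries the whole crux. This is complementary
to dilation detection (`stub_dilationDetection`: one node `M = 1`, all widths `ε ≥ 1`): the RH content of
the crux sits at `εM → ∞` from either side, while every cell with `εM ≤ c₀` holds unconditionally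
(`CombSubcritical`).

**Proof.** Fix an off-line zero `ρ₀` (it exists if RH fails). At a width `ε` with `crux(ε)`, the
two-node cells, polarisation and density give `‖B_{φ_ε}(x)‖ ≤ Re Q(φ_ε)` on `ℝ` for the exponential
series `B_{φ_ε}(x) = Σ_ρ m(ρ) P_{φ_ε}(ρ) e^{(ρ−½)x}` (`combShapeDetection_norm_expSum_le_of_nodes`), so the
bounded-power-sum lemma kills every off-line coefficient: `m(ρ₀) P_{φ_ε}(ρ₀) = 0`
(`combShapeDetection_order_mul_pairCoeff_eq_zero`). Since `P_{φ_ε}(ρ₀) = Φ₀(ε(ρ₀ − ½))²`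
(`pairCoeff_bump_eq_sq`, `Φ₀(z) = ∫ φ₀(u) e^{zu} du`) and `m(ρ₀) ≥ 1`, the width `ε` is a real zero of the
entire function `z ↦ Φ₀(z(ρ₀ − ½))`, which does not vanish at `z = 0` (`Φ₀(0) = ∫ φ₀ > 0`). The real
zeros of a non-zero entire function are countable (finitely many in each `[−n, n]` by the identity
principle and Bolzano–Weierstrass).

Corollaries in this file: `riemannHypothesis_of_cruxAt_of_not_countable`, `riemannHypothesis_iff_cruxAt_Icc`,
and — through the fixed-width two-prime collapse `stub_twoPrimeCollapse` — the Fejér forms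
`cruxAt_iff_fejer_two_three` (at each width: crux ⟺ the Fejér faces on the torus `T²_{2,3}` ⟺ on every
prime torus) and `riemannHypothesis_iff_fejer_two_three_Icc`.
-/

noncomputable section

-- the sub-problem path RiemannHypothesis/RiemannHypothesis duplicates a namespace (D-0017)
set_option linter.dupNamespace false

open scoped BigOperators ComplexConjugate Real Topology
open Complex MeasureTheory Set Filter

namespace Summit.RiemannHypothesis.RiemannHypothesis.Theorems.WeilCombBohrFejer

open Literature.NumberTheory.LFunctions
open Literature.NumberTheory.LFunctions.WeilConverse
open Summit.RiemannHypothesis.RiemannHypothesis.Theses.WeilComb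

/-! ## Notation (local, purely syntactic abbreviations of sub-terms of the registered stub) -/

/-- the route bump `φ_ε(t) = ε⁻¹ φ₀(t/ε)`. -/
local notation "φb(" ε ")" =>
  (fun t : ℝ => ((ε : ℝ) : ℂ)⁻¹ * ((expNegInvGlue (1 - (t / ε) ^ 2) : ℝ) : ℂ))

/-- the entire transform `Φ₀(z) = ∫ φ₀(u) e^{zu} du` of the fixed bump. -/
local notation "Φ₀(" z ")" =>
  (∫ u : ℝ, ((expNegInvGlue (1 - u ^ 2) : ℝ) : ℂ) * Complex.exp (z * u))

/-- the set of non-trivial zeros. -/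
local notation "𝒵" => ZetaZeros.riemannZetaNontrivialZeros

set_option quotPrecheck false in
/-- `crux(ε)`: every cell `(M, a)` of the crux at the single width `ε`. -/
local notation "cruxAt(" ε ")" =>
  (∀ (M : ℕ) (a : ℕ → ℂ), 0 ≤ (weilQuadratic (fun x : ℝ => ∑ m ∈ Finset.Icc 1 M,
    a m * (((ε : ℝ) : ℂ)⁻¹ * ((expNegInvGlue (1 - ((x - Real.log (m : ℝ)) / ε) ^ 2) : ℝ) : ℂ)))).re)

set_option quotPrecheck false in
/-- the Fejér face `Re Σ_{d,d' ∣ ∏_{p∈S} p^n} χ_θ(d) conj χ_θ(d') w_ε(log d − log d')`. -/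
local notation "face(" ε ", " S ", " n ", " θ ")" =>
  (Complex.re (∑ d ∈ (∏ p ∈ S, p ^ n).divisors, ∑ d' ∈ (∏ p ∈ S, p ^ n).divisors,
    Complex.exp (I * ((∑ p ∈ S, θ p * (d.factorization p : ℝ) : ℝ) : ℂ)) *
      conj (Complex.exp (I * ((∑ p ∈ S, θ p * (d'.factorization p : ℝ) : ℝ) : ℂ))) *
      weilFunctional (weilTranslate
        (weilConv (fun t : ℝ => ((ε : ℝ) : ℂ)⁻¹ * ((expNegInvGlue (1 - (t / ε) ^ 2) : ℝ) : ℂ))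
          (weilReflect (fun t : ℝ => ((ε : ℝ) : ℂ)⁻¹ * ((expNegInvGlue (1 - (t / ε) ^ 2) : ℝ) : ℂ))))
        (Real.log (d : ℝ) - Real.log (d' : ℝ)))))

/-! ## A · real zeros of a non-zero entire function are countable -/

/-- The real zeros of an entire function which is not identically zero form a countable set: in each
compact interval `[−n, n]` there are only finitely many (an injective sequence of zeros would have a
convergent subsequence, and the identity principle would force `g ≡ 0`). [folklore] -/
theorem countable_real_zeros_of_differentiable {g : ℂ → ℂ} (hg : Differentiable ℂ g) {z₁ : ℂ}
    (hz₁ : g z₁ ≠ 0) : Set.Countable {x : ℝ | g (x : ℂ) = 0} := by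
  have han : AnalyticOnNhd ℂ g univ := hg.differentiableOn.analyticOnNhd isOpen_univ
  -- finitely many zeros in each `[-n, n]`
  have hfin : ∀ n : ℕ, ({x : ℝ | g (x : ℂ) = 0} ∩ Icc (-(n : ℝ)) n).Finite := by
    intro n
    by_contra hinf
    set Z : Set ℝ := {x : ℝ | g (x : ℂ) = 0} ∩ Icc (-(n : ℝ)) n with hZ
    have hZinf : Z.Infinite := hinf
    -- an injective sequence in `Z`, a convergent subsequence
    set u : ℕ → ℝ := fun k => (Set.Infinite.natEmbedding Z hZinf k : ℝ) with hu
    have hu_mem : ∀ k, u k ∈ Z := fun k => (Set.Infinite.natEmbedding Z hZinf k).2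
    have hu_inj : Function.Injective u := fun k l hkl =>
      (Set.Infinite.natEmbedding Z hZinf).injective (Subtype.ext hkl)
    obtain ⟨x₀, -, φ, hφ, hlim⟩ :=
      (isCompact_Icc : IsCompact (Icc (-(n : ℝ)) n)).tendsto_subseq fun k => (hu_mem k).2
    have hinj : Function.Injective (u ∘ φ) := hu_inj.comp hφ.injective
    -- `x₀` is in the closure of the other zeros
    have hmem : ((x₀ : ℝ) : ℂ) ∈ closure ({z : ℂ | g z = 0} \ {((x₀ : ℝ) : ℂ)}) := by
      refine mem_closure_of_tendsto ((Complex.continuous_ofReal.tendsto x₀).comp hlim) ?_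
      have hev : ∀ᶠ k in atTop, u (φ k) ≠ x₀ := by
        by_cases h : ∃ k, u (φ k) = x₀
        · obtain ⟨k₀, hk₀⟩ := h
          refine eventually_atTop.2 ⟨k₀ + 1, fun k hk heq => ?_⟩
          have : k = k₀ := hinj (heq.trans hk₀.symm)
          omega
        · push Not at h
          exact Eventually.of_forall h
      filter_upwards [hev] with k hk
      refine ⟨(hu_mem (φ k)).1, ?_⟩
      rw [mem_singleton_iff]
      exact fun heq => hk (Complex.ofReal_injective heq)
    have hzero := han.eqOn_zero_of_preconnected_of_mem_closure isPreconnected_univ (mem_univ _) hmem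
    exact hz₁ (hzero (mem_univ z₁))
  have hcover : {x : ℝ | g (x : ℂ) = 0} = ⋃ n : ℕ, ({x : ℝ | g (x : ℂ) = 0} ∩ Icc (-(n : ℝ)) n) := by
    ext x
    simp only [mem_iUnion, mem_inter_iff, mem_setOf_eq, mem_Icc]
    constructor
    · intro hx
      obtain ⟨n, hn⟩ := exists_nat_ge |x|
      exact ⟨n, hx, by linarith [neg_abs_le x], (le_abs_self x).trans hn⟩
    · rintro ⟨n, hx, -⟩
      exact hx
  rw [hcover]
  exact countable_iUnion fun n => (hfin n).countable

/-! ## B · one width: two-node cells, bounded exponential series, no off-line coefficients -/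

/-- Two-node cells at ONE width: if every cell `(M, a)` at width `ε` holds then
`0 ≤ Re Q(φ_ε + c·φ_ε(· − (log m₂ − log m₁)))` for all positive naturals `m₁, m₂` and all `c`
(the comb `a = 1_{m₁} + c 1_{m₂}` at level `max m₁ m₂`, translated by `log m₁`; copy of
`combShapeDetection_two_node_nonneg` with its hypothesis localised to the width `ε`). [folklore] -/
theorem two_node_nonneg_of_cruxAt {ε : ℝ} (hcrux : cruxAt(ε)) {m₁ m₂ : ℕ} (h₁ : 0 < m₁) (h₂ : 0 < m₂)
    (c : ℂ) :
    0 ≤ (weilQuadratic (translateMix φb(ε) c (Real.log m₂ - Real.log m₁))).re := by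
  set Φ : ℝ → ℂ := φb(ε)
  set M : ℕ := max m₁ m₂
  set a : ℕ → ℂ := fun m ↦ (if m = m₁ then 1 else 0) + (if m = m₂ then c else 0) with ha
  have hm₁ : m₁ ∈ Finset.Icc 1 M := Finset.mem_Icc.2 ⟨h₁, le_max_left _ _⟩
  have hm₂ : m₂ ∈ Finset.Icc 1 M := Finset.mem_Icc.2 ⟨h₂, le_max_right _ _⟩
  have key := hcrux M a
  have e : (fun x : ℝ => ∑ m ∈ Finset.Icc 1 M, a m * (((ε : ℝ) : ℂ)⁻¹ *
      ((expNegInvGlue (1 - ((x - Real.log (m : ℝ)) / ε) ^ 2) : ℝ) : ℂ))) =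
      fun t ↦ translateMix Φ c (Real.log m₂ - Real.log m₁) (t + -Real.log m₁) := by
    funext x
    have hsum : ∑ m ∈ Finset.Icc 1 M, a m * Φ (x - Real.log m) =
        Φ (x - Real.log m₁) + c * Φ (x - Real.log m₂) := by
      simp only [ha, add_mul, Finset.sum_add_distrib, ite_mul, one_mul, zero_mul,
        Finset.sum_ite_eq', hm₁, hm₂, if_true]
    show ∑ m ∈ Finset.Icc 1 M, a m * Φ (x - Real.log m) = _
    rw [hsum, show x + -Real.log m₁ = x - Real.log m₁ by ring]
    simp only [translateMix, Pi.add_apply, weilTranslate]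
    rw [show x - Real.log m₁ - (Real.log m₂ - Real.log m₁) = x - Real.log m₂ by ring]
  rw [e, weilQuadratic_translate (translateMix Φ c (Real.log m₂ - Real.log m₁)) (-Real.log m₁)]
    at key
  exact key

/-- At ONE width: `crux(ε)` kills every off-line coefficient of the exponential series of `φ_ε`:
`m(ρ) P_{φ_ε}(ρ) = 0` whenever `Re ρ ≠ 1/2` (two-node cells ⇒ `‖B_{φ_ε}‖ ≤ Re Q(φ_ε)` on `ℝ` by
polarisation and density ⇒ bounded power sums have no real exponents). [cite: Bombieri2000, §3 Thm 1] -/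
theorem order_mul_pairCoeff_eq_zero_of_cruxAt {ε : ℝ} (hcrux : cruxAt(ε)) {ρ : ℂ} (hρ : ρ ∈ 𝒵)
    (hre : ρ.re ≠ 1 / 2) : (riemannZetaZeroOrder ρ : ℂ) * pairCoeff φb(ε) ρ = 0 := by
  have hΦt : IsWeilTest φb(ε) := combShapeDetection_shapeBump_isWeilTest ε
  have hD : ∀ m₁ m₂ : ℕ, 0 < m₁ → 0 < m₂ → ∀ c : ℂ,
      0 ≤ (weilQuadratic (translateMix φb(ε) c (Real.log m₂ - Real.log m₁))).re :=
    fun m₁ m₂ hm₁ hm₂ c => two_node_nonneg_of_cruxAt hcrux hm₁ hm₂ c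
  exact combShapeDetection_order_mul_pairCoeff_eq_zero hΦt
    (combShapeDetection_norm_expSum_le_of_nodes hΦt hD) hρ hre

/-- `Φ₀(0) = ∫ φ₀ ≠ 0` (it is the positive number `Re φ̂₁(1/2)`,
`combShapeDetection_re_weilMellin_shapeBump_pos`). [folklore] -/
theorem integral_shapeBump_ne_zero : (∫ u : ℝ, ((expNegInvGlue (1 - u ^ 2) : ℝ) : ℂ)) ≠ 0 := by
  have hpos := combShapeDetection_re_weilMellin_shapeBump_pos (ε := 1) (γ := 0) one_pos
    (by simp) (1 / 2)
  have e1 := weilMellin_bump (ε := 1) one_pos ((((1 / 2 : ℝ)) : ℂ) + ((0 : ℝ) : ℂ) * I)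
  have harg : (((1 : ℝ)) : ℂ) * (((((1 / 2 : ℝ)) : ℂ) + ((0 : ℝ) : ℂ) * I) - 1 / 2) = 0 := by
    push_cast
    ring
  rw [harg] at e1
  simp only [zero_mul, Complex.exp_zero, mul_one] at e1
  intro h0
  rw [e1, h0, Complex.zero_re] at hpos
  exact lt_irrefl _ hpos

/-- At ONE width: if `crux(ε)` holds (`ε > 0`) and `ρ₀` is an off-line non-trivial zero, then `ε` is a
real zero of the entire function `z ↦ Φ₀(z(ρ₀ − ½))` (`P_{φ_ε}(ρ₀) = Φ₀(ε(ρ₀ − ½))²`, `m(ρ₀) ≥ 1`). [folklore] -/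
theorem bumpTransform_ray_eq_zero_of_cruxAt {ε : ℝ} (hε : 0 < ε) (hcrux : cruxAt(ε)) {ρ₀ : ℂ}
    (hρ₀ : ρ₀ ∈ 𝒵) (hre : ρ₀.re ≠ 1 / 2) : Φ₀(((ε : ℝ) : ℂ) * (ρ₀ - 1 / 2)) = 0 := by
  have h := order_mul_pairCoeff_eq_zero_of_cruxAt hcrux hρ₀ hre
  have hm : (riemannZetaZeroOrder ρ₀ : ℂ) ≠ 0 := by
    have := ZetaZeros.riemannZetaNontrivialZeros.one_le_order hρ₀
    exact_mod_cast (by omega : riemannZetaZeroOrder ρ₀ ≠ 0)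
  have hP : pairCoeff φb(ε) ρ₀ = 0 := (mul_eq_zero.1 h).resolve_left hm
  rw [pairCoeff_bump_eq_sq hε] at hP
  exact pow_eq_zero_iff two_ne_zero |>.1 hP

/-! ## C · the registered stub and its corollaries -/

/-- **`stub_widthRigidity` — WIDTH RIGIDITY of fixed-shape comb positivity.** If the Riemann
hypothesis fails, the set of widths `ε > 0` at which every cell `(M, a)` of the crux holds is
countable: all these widths are real zeros of the entire function `z ↦ Φ₀(z(ρ₀ − ½))` attached to one
off-line zero `ρ₀`, and that function does not vanish at `0`. [folklore] -/
theorem stub_widthRigidity : ¬ RiemannHypothesis →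
    Set.Countable {ε : ℝ | 0 < ε ∧ ∀ (M : ℕ) (a : ℕ → ℂ),
      0 ≤ (weilQuadratic (fun x : ℝ => ∑ m ∈ Finset.Icc 1 M,
        a m * ((ε : ℂ)⁻¹ * ((expNegInvGlue (1 - ((x - Real.log (m : ℝ)) / ε) ^ 2) : ℝ) : ℂ)))).re} := by
  intro hRH
  -- an off-line non-trivial zero
  obtain ⟨ρ₀, hρ₀, hoff⟩ : ∃ ρ₀ : ℂ, ρ₀ ∈ 𝒵 ∧ ρ₀.re ≠ 1 / 2 := by
    by_contra hall
    push Not at hall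
    exact hRH (riemannHypothesis_iff_strip_holds.2 fun ρ hζ h0 h1 =>
      hall ρ (ZetaZeros.riemannZetaNontrivialZeros.mem_iff'.2 ⟨hζ, h0, h1⟩))
  -- the entire function `g(z) = Φ₀(z (ρ₀ − ½))`, non-zero at `0`
  set g : ℂ → ℂ := fun z => Φ₀(z * (ρ₀ - 1 / 2)) with hg
  have hgd : Differentiable ℂ g := by
    have e : g = (fun z : ℂ => Φ₀(z)) ∘ fun z : ℂ => z * (ρ₀ - 1 / 2) := rfl
    rw [e]
    exact differentiable_bumpTransform.comp (differentiable_id.mul_const _)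
  have hg0 : g 0 ≠ 0 := by
    simp only [hg, zero_mul, Complex.exp_zero, mul_one]
    exact integral_shapeBump_ne_zero
  refine (countable_real_zeros_of_differentiable hgd hg0).mono ?_
  rintro ε ⟨hε, hcrux⟩
  exact bumpTransform_ray_eq_zero_of_cruxAt hε hcrux hρ₀ hoff

/-- **One generic width is RH-complete.** If the cells of the crux hold at every width of an
UNCOUNTABLE set `E ⊆ (0, ∞)` (all `M`, `a`), the Riemann hypothesis follows. [folklore] -/
theorem riemannHypothesis_of_cruxAt_of_not_countable {E : Set ℝ} (hE : ¬ E.Countable)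
    (hpos : ∀ ε ∈ E, 0 < ε) (hcrux : ∀ ε ∈ E, cruxAt(ε)) : RiemannHypothesis := by
  by_contra hRH
  refine hE ((stub_widthRigidity hRH).mono ?_)
  intro ε hεE
  exact ⟨hpos ε hεE, hcrux ε hεE⟩

/-- A non-degenerate real interval is uncountable. [folklore] -/
theorem not_countable_Icc {ε₁ ε₂ : ℝ} (h : ε₁ < ε₂) : ¬ (Icc ε₁ ε₂).Countable := by
  intro hc
  have h1 := hc.mono (Ioo_subset_Icc_self (a := ε₁) (b := ε₂))
  rw [← Cardinal.le_aleph0_iff_set_countable, Cardinal.mk_Ioo_real h] at h1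
  exact h1.not_gt Cardinal.aleph0_lt_continuum

/-- RH ⇒ every cell of the crux (each comb is a Weil test; Weil positivity under RH). [folklore] -/
theorem cruxAt_of_riemannHypothesis (hRH : RiemannHypothesis) (ε : ℝ) (hε : 0 < ε) : cruxAt(ε) := by
  have hC : CombShapePositivity := by
    by_contra h
    exact Summit.RiemannHypothesis.RiemannHypothesis.Theorems.weilComb_not_riemannHypothesis_of_not_combShapePositivity
      h hRH
  exact hC ε hε

/-- **RH ⟺ the crux on one width interval.** For `0 < ε₁ < ε₂`:
`RiemannHypothesis ⟺ ∀ ε ∈ [ε₁, ε₂], ∀ M a, 0 ≤ Re Q(comb)`. [folklore] -/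
theorem riemannHypothesis_iff_cruxAt_Icc {ε₁ ε₂ : ℝ} (h₁ : 0 < ε₁) (h₁₂ : ε₁ < ε₂) :
    RiemannHypothesis ↔ ∀ ε ∈ Icc ε₁ ε₂, cruxAt(ε) := by
  constructor
  · intro hRH ε hε
    exact cruxAt_of_riemannHypothesis hRH ε (h₁.trans_le hε.1)
  · intro h
    exact riemannHypothesis_of_cruxAt_of_not_countable (not_countable_Icc h₁₂)
      (fun ε hε => h₁.trans_le hε.1) h

/-! ## D · Fejér form: at each width the torus `T²_{2,3}` carries the crux -/

/-- **Fixed-width collapse, Fejér form.** At each width `ε > 0`: every cell `(M, a)` of the crux holds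
iff the Fejér faces on the single torus `T²_{2,3}` are all `≥ 0` (`⇐`: `stub_twoPrimeCollapse`;
`⇒`: each face is the cell `M = 6^n`, `a = χ_θ 1_{· ∣ 6^n}`, `fejer_of_cell`). [folklore] -/
theorem cruxAt_iff_fejer_two_three {ε : ℝ} (hε : 0 < ε) :
    cruxAt(ε) ↔ ∀ (n : ℕ) (θ : ℕ → ℝ), 0 ≤ face(ε, ({2, 3} : Finset ℕ), n, θ) := by
  have hS : ∀ p ∈ ({2, 3} : Finset ℕ), p.Prime := by
    intro p hp
    simp only [Finset.mem_insert, Finset.mem_singleton] at hp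
    rcases hp with rfl | rfl <;> norm_num
  constructor
  · intro h n θ
    exact fejer_of_cell hε hS n θ fun a => h _ a
  · intro h M a
    exact stub_twoPrimeCollapse ε hε {2, 3} hS (by decide) h M a

/-- At each width `ε > 0`: the crux holds iff the Fejér faces on EVERY prime torus are `≥ 0`. [folklore] -/
theorem cruxAt_iff_fejer_all {ε : ℝ} (hε : 0 < ε) :
    cruxAt(ε) ↔ ∀ S : Finset ℕ, (∀ p ∈ S, p.Prime) → ∀ (n : ℕ) (θ : ℕ → ℝ), 0 ≤ face(ε, S, n, θ) := by
  constructor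
  · intro h S hS n θ
    exact fejer_of_cell hε hS n θ fun a => h _ a
  · intro h
    have hS : ∀ p ∈ ({2, 3} : Finset ℕ), p.Prime := by
      intro p hp
      simp only [Finset.mem_insert, Finset.mem_singleton] at hp
      rcases hp with rfl | rfl <;> norm_num
    exact (cruxAt_iff_fejer_two_three hε).2 (h {2, 3} hS)

/-- **Width rigidity, Fejér form.** If RH fails, the set of widths at which all Fejér faces on
`T²_{2,3}` are `≥ 0` is countable. [folklore] -/
theorem countable_fejer_two_three_widths (hRH : ¬ RiemannHypothesis) :
    Set.Countable {ε : ℝ | 0 < ε ∧ ∀ (n : ℕ) (θ : ℕ → ℝ), 0 ≤ face(ε, ({2, 3} : Finset ℕ), n, θ)} := by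
  refine (stub_widthRigidity hRH).mono ?_
  rintro ε ⟨hε, h⟩
  exact ⟨hε, (cruxAt_iff_fejer_two_three hε).2 h⟩

/-- **RH ⟺ Fejér faces on `T²_{2,3}` over one width interval.** For `0 < ε₁ < ε₂`:
`RiemannHypothesis ⟺ ∀ ε ∈ [ε₁, ε₂], ∀ n θ, 0 ≤ Re Σ_{d,d' ∣ 6^n} χ_θ(d) conj χ_θ(d') w_ε(log d − log d')`.
[folklore] -/
theorem riemannHypothesis_iff_fejer_two_three_Icc {ε₁ ε₂ : ℝ} (h₁ : 0 < ε₁) (h₁₂ : ε₁ < ε₂) :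
    RiemannHypothesis ↔
      ∀ ε ∈ Icc ε₁ ε₂, ∀ (n : ℕ) (θ : ℕ → ℝ), 0 ≤ face(ε, ({2, 3} : Finset ℕ), n, θ) := by
  rw [riemannHypothesis_iff_cruxAt_Icc h₁ h₁₂]
  constructor
  · intro h ε hε
    exact (cruxAt_iff_fejer_two_three (h₁.trans_le hε.1)).1 (h ε hε)
  · intro h ε hε
    exact (cruxAt_iff_fejer_two_three (h₁.trans_le hε.1)).2 (h ε hε)

/-! ## E · sharpening: below any bound only FINITELY many widths survive -/

/-- The real zeros of a non-zero entire function in a compact interval `[a, b]` are finite (an injective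
sequence of zeros would have a convergent subsequence, and the identity principle would force `g ≡ 0`).
[folklore] -/
theorem finite_real_zeros_inter_Icc_of_differentiable {g : ℂ → ℂ} (hg : Differentiable ℂ g) {z₁ : ℂ}
    (hz₁ : g z₁ ≠ 0) (a b : ℝ) : ({x : ℝ | g (x : ℂ) = 0} ∩ Icc a b).Finite := by
  have han : AnalyticOnNhd ℂ g univ := hg.differentiableOn.analyticOnNhd isOpen_univ
  by_contra hinf
  set Z : Set ℝ := {x : ℝ | g (x : ℂ) = 0} ∩ Icc a b with hZ
  have hZinf : Z.Infinite := hinf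
  -- an injective sequence in `Z`, a convergent subsequence
  set u : ℕ → ℝ := fun k => (Set.Infinite.natEmbedding Z hZinf k : ℝ) with hu
  have hu_mem : ∀ k, u k ∈ Z := fun k => (Set.Infinite.natEmbedding Z hZinf k).2
  have hu_inj : Function.Injective u := fun k l hkl =>
    (Set.Infinite.natEmbedding Z hZinf).injective (Subtype.ext hkl)
  obtain ⟨x₀, -, φ, hφ, hlim⟩ :=
    (isCompact_Icc : IsCompact (Icc a b)).tendsto_subseq fun k => (hu_mem k).2
  have hinj : Function.Injective (u ∘ φ) := hu_inj.comp hφ.injective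
  -- `x₀` is in the closure of the other zeros
  have hmem : ((x₀ : ℝ) : ℂ) ∈ closure ({z : ℂ | g z = 0} \ {((x₀ : ℝ) : ℂ)}) := by
    refine mem_closure_of_tendsto ((Complex.continuous_ofReal.tendsto x₀).comp hlim) ?_
    have hev : ∀ᶠ k in atTop, u (φ k) ≠ x₀ := by
      by_cases h : ∃ k, u (φ k) = x₀
      · obtain ⟨k₀, hk₀⟩ := h
        refine eventually_atTop.2 ⟨k₀ + 1, fun k hk heq => ?_⟩
        have : k = k₀ := hinj (heq.trans hk₀.symm)
        omega
      · push Not at h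
        exact Eventually.of_forall h
    filter_upwards [hev] with k hk
    refine ⟨(hu_mem (φ k)).1, ?_⟩
    rw [mem_singleton_iff]
    exact fun heq => hk (Complex.ofReal_injective heq)
  have hzero := han.eqOn_zero_of_preconnected_of_mem_closure isPreconnected_univ (mem_univ _) hmem
  exact hz₁ (hzero (mem_univ z₁))

/-- **`stub_widthRigidityFinite` — width rigidity, finite form** (registered helper). If the Riemann
hypothesis fails then, below any bound `R`, only FINITELY many widths `ε ∈ (0, R]` carry every cell
`(M, a)` of the crux (the surviving widths are real zeros in `[0, R]` of the entire function
`z ↦ Φ₀(z(ρ₀ − ½))`, which is non-zero at `0`). [folklore] -/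
theorem stub_widthRigidityFinite : ¬ RiemannHypothesis → ∀ R : ℝ,
    Set.Finite {ε : ℝ | 0 < ε ∧ ε ≤ R ∧ ∀ (M : ℕ) (a : ℕ → ℂ),
      0 ≤ (weilQuadratic (fun x : ℝ => ∑ m ∈ Finset.Icc 1 M,
        a m * ((ε : ℂ)⁻¹ * ((expNegInvGlue (1 - ((x - Real.log (m : ℝ)) / ε) ^ 2) : ℝ) : ℂ)))).re} := by
  intro hRH R
  -- an off-line non-trivial zero
  obtain ⟨ρ₀, hρ₀, hoff⟩ : ∃ ρ₀ : ℂ, ρ₀ ∈ 𝒵 ∧ ρ₀.re ≠ 1 / 2 := by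
    by_contra hall
    push Not at hall
    exact hRH (riemannHypothesis_iff_strip_holds.2 fun ρ hζ h0 h1 =>
      hall ρ (ZetaZeros.riemannZetaNontrivialZeros.mem_iff'.2 ⟨hζ, h0, h1⟩))
  set g : ℂ → ℂ := fun z => Φ₀(z * (ρ₀ - 1 / 2)) with hg
  have hgd : Differentiable ℂ g := by
    have e : g = (fun z : ℂ => Φ₀(z)) ∘ fun z : ℂ => z * (ρ₀ - 1 / 2) := rfl
    rw [e]
    exact differentiable_bumpTransform.comp (differentiable_id.mul_const _)
  have hg0 : g 0 ≠ 0 := by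
    simp only [hg, zero_mul, Complex.exp_zero, mul_one]
    exact integral_shapeBump_ne_zero
  refine (finite_real_zeros_inter_Icc_of_differentiable hgd hg0 0 R).subset ?_
  rintro ε ⟨hε, hεR, hcrux⟩
  exact ⟨bumpTransform_ray_eq_zero_of_cruxAt hε hcrux hρ₀ hoff, hε.le, hεR⟩

/-- **Fejér form of the finite version.** If RH fails then, below any bound `R`, only finitely many
widths `ε ∈ (0, R]` have all Fejér faces on `T²_{2,3}` non-negative. [folklore] -/
theorem finite_fejer_two_three_widths_le (hRH : ¬ RiemannHypothesis) (R : ℝ) :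
    Set.Finite {ε : ℝ | 0 < ε ∧ ε ≤ R ∧ ∀ (n : ℕ) (θ : ℕ → ℝ), 0 ≤ face(ε, ({2, 3} : Finset ℕ), n, θ)} := by
  refine (stub_widthRigidityFinite hRH R).subset ?_
  rintro ε ⟨hε, hεR, h⟩
  exact ⟨hε, hεR, (cruxAt_iff_fejer_two_three hε).2 h⟩

end Summit.RiemannHypothesis.RiemannHypothesis.Theorems.WeilCombBohrFejer

end
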